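import Summits.Ventures.PercRepro.C041RcPortCS

/-!
# (CS) ON THE SOURCES OF A COLOURING WHOSE TERMINAL-ADJACENT ZONES ARE ALL rc — the base case of (O-CUBE) in its
(CS) form (p6, gen 28; C-041.md §5 (b), §17 (a))

Setting of `C041RcPortCS` / `C041RcPortTheoremR`.  When every terminal-adjacent zone of `O` is internally
red-connected (in particular when `B(O) = ∅`, every such zone a singleton), every source with bare colouring `O` is
an rc source (`srcSetO_eq_rcSrcSet`, gen 24), so THEOREM R-CS ON SKELETONS applies to the whole family `𝒮(O)`:

* `rc_cs_of_bare_adj` — with the probe adjacent to a terminal every source of `𝒮_rc(O)` is Good on one fixed side;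
* **`src_cs_of_rc_zones`** — on every skeleton with an edge between the terminals, `c ≠ a, b`, `a ≠ b`, for every
  bare colouring `O` all of whose terminal-adjacent zones are rc: `(#𝒮(O) − #Good_a − #Good_b)₊² ≤ #Good_a · #Good_b`
  — the (CS) form of gen 24's `sum_goodDegree_nonneg_of_rc_zones` (THEOREM R as the base case of (O-CUBE)).
-/

namespace PercRepro

namespace MultiGraph

open Finset ZonePort CSCount

variable {V E : Type*} {G : MultiGraph V E}

section Base

variable [Fintype V] [Fintype E] [DecidableEq E] (a b c : V) (O : Config E)

open Classical in
/-- The sources with bare colouring `O` and `Good_a`. -/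
noncomputable def srcGoodAO (G : MultiGraph V E) : Finset (Config E) :=
  (G.srcSetO a b c O).filter fun S => G.WalkAvoiding S (G.cluster Sᶜ a) c b

open Classical in
/-- The sources with bare colouring `O` and `Good_b`. -/
noncomputable def srcGoodBO (G : MultiGraph V E) : Finset (Config E) :=
  (G.srcSetO a b c O).filter fun S => G.WalkAvoiding S (G.cluster Sᶜ b) c a

open Classical in
/-- With the probe adjacent to a terminal, every source of `𝒮_rc(O)` is Good on one fixed side, so (CS) holds. -/
theorem rc_cs_of_bare_adj (hadj : ∃ e, G.Joins e c a ∨ G.Joins e c b) :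
    CS #(G.rcSrcSet a b c O) #(G.rcGoodA a b c O) #(G.rcGoodB a b c O) := by
  apply cs_of_le
  obtain ⟨e, he | he⟩ := hadj
  · have hsub : G.rcSrcSet a b c O ⊆ G.rcGoodB a b c O := by
      intro S hS
      rw [mem_rcGoodB]
      rw [mem_rcSrcSet] at hS
      exact ⟨hS, goodB_of_adj_a a b c hS.2.2 he⟩
    have := card_le_card hsub
    omega
  · have hsub : G.rcSrcSet a b c O ⊆ G.rcGoodA a b c O := by
      intro S hS
      rw [mem_rcGoodA]
      rw [mem_rcSrcSet] at hS
      exact ⟨hS, goodA_of_adj_b a b c hS.2.2 he⟩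
    have := card_le_card hsub
    omega

open Classical in
/-- **(CS) ON `𝒮(O)` WHEN EVERY TERMINAL-ADJACENT ZONE OF `O` IS rc** — the (CS) form of THEOREM R as the base case
of (O-CUBE): on every skeleton with an edge between the terminals, `c ≠ a, b`, `a ≠ b`,
`(#𝒮(O) − #Good_a − #Good_b)₊² ≤ #Good_a · #Good_b`. -/
theorem src_cs_of_rc_zones (hca : c ≠ a) (hcb : c ≠ b) (hne : a ≠ b) (habE : ∃ e, G.Joins e a b)
    (hO : ∀ u, (∃ e, G.Joins e u a ∨ G.Joins e u b) → G.Rc a b O u) :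
    CS #(G.srcSetO a b c O) #(G.srcGoodAO a b c O) #(G.srcGoodBO a b c O) := by
  have e1 : G.srcGoodAO a b c O = G.rcGoodA a b c O := by
    unfold srcGoodAO rcGoodA
    rw [srcSetO_eq_rcSrcSet a b c hO]
  have e2 : G.srcGoodBO a b c O = G.rcGoodB a b c O := by
    unfold srcGoodBO rcGoodB
    rw [srcSetO_eq_rcSrcSet a b c hO]
  rw [srcSetO_eq_rcSrcSet a b c hO, e1, e2]
  by_cases hadj : ∃ e, G.Joins e c a ∨ G.Joins e c b
  · exact rc_cs_of_bare_adj a b c O hadj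
  · have hc : ∀ e, ¬ G.Joins e c a ∧ ¬ G.Joins e c b :=
      fun e => ⟨fun h => hadj ⟨e, Or.inl h⟩, fun h => hadj ⟨e, Or.inr h⟩⟩
    exact rc_cs_of_bare hca hcb hc hne habE O

end Base

end MultiGraph

end PercRepro
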